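import Mathlib.Algebra.Algebra.Operations
import Mathlib.Algebra.Order.Monoid.Unbundled.Pow
import Mathlib.Tactic.Ring
import HarnessLib

/-!
# Venture HSemireg — powers of a hyperplane submodule: two degrees decide all

The degree bookkeeping behind THEOREM Γ-1⁵ (normal form of the five-sheet germ) of the computation
cell `pub-hsemireg` (seat w1-tw-1, `widen/W1/CLEAN-COMPONENT-THEOREM-w1tw1.md` §26.1 (δ)): in a
commutative algebra `A` over `k`, let `S ≤ T` be `k`-submodules with `T ≤ S ⊔ k ∙ e` for some
`e ∈ T` (the case of interest: `T` = the degree-one part of a standard graded algebra, `S` a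
hyperplane in it). If the products agree in degrees two and three, `S² = T²` and `S³ = T³`, then
`Sᵐ = Tᵐ` for every `m ≥ 2`: the extra generator `e` is absorbed because
`e · Sᵐ⁻¹ = S · (e · Sᵐ⁻²) ≤ S · (T · Tᵐ⁻²) = S · Tᵐ⁻¹ = S · Sᵐ⁻¹ = Sᵐ`.
(In §26.1 this propagates the Hilbert-function coincidence `11, 16` of the five-plane germ `five5`
with the free Stanley–Reisner path ring from degrees `2, 3` to all degrees; degree `3` is a genuine
base case.)

* `pow_le_pow_of_le` — monotonicity `S ≤ T → S ^ n ≤ T ^ n` for submodules of an algebra;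
* `span_mul_pow_le` — the absorption step `(k ∙ e) * S ^ (n + 2) ≤ S ^ (n + 3)` given
  `S ^ (n + 2) = T ^ (n + 2)`, `S ≤ T`, `k ∙ e ≤ T`;
* `pow_eq_pow_of_sq_eq_of_cube_eq` — the statement above.

HONEST FRAMING. Elementary manipulation of products of submodules (Mathlib's `IdemCommSemiring`
structure on `Submodule k A`); the Lean index of ONE three-line induction of a hand proof. No germ,
sheaf, abelian variety or semiregularity map appears; nothing here says that HC, HC_CM or HC_AV
holds, and nothing here is a new case of anything.
-/

namespace Summit.Ventures.HSemireg

namespace HyperplanePowers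

open Submodule

variable {k A : Type*} [CommSemiring k] [CommSemiring A] [Algebra k A]

/-- Monotonicity of powers of submodules of an algebra: `S ≤ T → S ^ n ≤ T ^ n`. -/
theorem pow_le_pow_of_le {S T : Submodule k A} (h : S ≤ T) (n : ℕ) : S ^ n ≤ T ^ n := by
  induction n with
  | zero => simp
  | succ n ih =>
    rw [pow_succ, pow_succ]
    exact mul_le_mul' ih h

/-- The absorption step: if `S ≤ T`, `k ∙ e ≤ T` and `S ^ (n + 2) = T ^ (n + 2)`, then
`(k ∙ e) * S ^ (n + 2) ≤ S ^ (n + 3)` — because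
`(k ∙ e) * S ^ (n + 2) = S * ((k ∙ e) * S ^ (n + 1)) ≤ S * (T * T ^ (n + 1)) = S * S ^ (n + 2)`. -/
theorem span_mul_pow_le {S T : Submodule k A} {e : A} (hST : S ≤ T) (he : k ∙ e ≤ T)
    (n : ℕ) (hn : S ^ (n + 2) = T ^ (n + 2)) :
    (k ∙ e) * S ^ (n + 2) ≤ S ^ (n + 3) := by
  have h1 : (k ∙ e) * S ^ (n + 2) = S * ((k ∙ e) * S ^ (n + 1)) := by ring
  have h2 : (k ∙ e) * S ^ (n + 1) ≤ S ^ (n + 2) := by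
    calc (k ∙ e) * S ^ (n + 1) ≤ T * T ^ (n + 1) := mul_le_mul' he (pow_le_pow_of_le hST _)
      _ = T ^ (n + 2) := by ring
      _ = S ^ (n + 2) := hn.symm
  calc (k ∙ e) * S ^ (n + 2) = S * ((k ∙ e) * S ^ (n + 1)) := h1
    _ ≤ S * S ^ (n + 2) := mul_le_mul' le_rfl h2
    _ = S ^ (n + 3) := by ring

/-- **Two degrees decide all.** In a commutative `k`-algebra, if `S ≤ T ≤ S ⊔ k ∙ e` with
`k ∙ e ≤ T`, and `S ^ 2 = T ^ 2`, `S ^ 3 = T ^ 3`, then `S ^ m = T ^ m` for every `m ≥ 2`. -/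
theorem pow_eq_pow_of_sq_eq_of_cube_eq {S T : Submodule k A} {e : A} (hST : S ≤ T)
    (he : k ∙ e ≤ T) (hTS : T ≤ S ⊔ k ∙ e) (h2 : S ^ 2 = T ^ 2) (h3 : S ^ 3 = T ^ 3) :
    ∀ m, 2 ≤ m → S ^ m = T ^ m := by
  -- induction with a two-step memory: S^(n+2) = T^(n+2) ∧ S^(n+3) = T^(n+3)
  have key : ∀ n, S ^ (n + 2) = T ^ (n + 2) ∧ S ^ (n + 3) = T ^ (n + 3) := by
    intro n
    induction n with
    | zero => exact ⟨h2, h3⟩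
    | succ n ih =>
      obtain ⟨_, ihn3⟩ := ih
      refine ⟨ihn3, le_antisymm (pow_le_pow_of_le hST _) ?_⟩
      -- T^(n+4) = T * T^(n+3) = T * S^(n+3) ≤ (S ⊔ k∙e) * S^(n+3) = S^(n+4) ⊔ (k∙e) * S^(n+3)
      have hsplit : T ^ (n + 1 + 3) ≤ S * S ^ (n + 3) ⊔ (k ∙ e) * S ^ (n + 3) := by
        calc T ^ (n + 1 + 3) = T * T ^ (n + 3) := by ring
          _ = T * S ^ (n + 3) := by rw [ihn3]
          _ ≤ (S ⊔ k ∙ e) * S ^ (n + 3) := mul_le_mul' hTS le_rfl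
          _ = S * S ^ (n + 3) ⊔ (k ∙ e) * S ^ (n + 3) := sup_mul _ _ _
      -- the e-part is absorbed by `span_mul_pow_le` at level n + 1
      have habs : (k ∙ e) * S ^ (n + 3) ≤ S ^ (n + 4) := span_mul_pow_le hST he (n + 1) ihn3
      calc T ^ (n + 1 + 3) ≤ S * S ^ (n + 3) ⊔ (k ∙ e) * S ^ (n + 3) := hsplit
        _ ≤ S ^ (n + 1 + 3) := by
          refine sup_le (le_of_eq (by ring)) ?_
          calc (k ∙ e) * S ^ (n + 3) ≤ S ^ (n + 4) := habs
            _ = S ^ (n + 1 + 3) := by ring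
  intro m hm
  obtain ⟨n, rfl⟩ := Nat.exists_eq_add_of_le hm
  rw [add_comm]
  exact (key n).1

/-- The form used in CC note §26.1 (δ): with `T = S ⊔ k ∙ e` (so `T` is the whole degree-one part
and `e ∈ T`), `S ^ 2 = T ^ 2` and `S ^ 3 = T ^ 3` force `S ^ m = T ^ m` for all `m ≥ 2`. -/
theorem pow_eq_pow_of_eq_sup_span {S T : Submodule k A} {e : A} (hT : T = S ⊔ k ∙ e)
    (h2 : S ^ 2 = T ^ 2) (h3 : S ^ 3 = T ^ 3) (m : ℕ) (hm : 2 ≤ m) : S ^ m = T ^ m :=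
  pow_eq_pow_of_sq_eq_of_cube_eq (hT ▸ le_sup_left) (hT ▸ le_sup_right) hT.le h2 h3 m hm

end HyperplanePowers

end Summit.Ventures.HSemireg
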